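import Mathlib
import Summits.CriticalPhenomena.CardyFormulaZ2.Theses.CardyFlipRusso
import Summits.CriticalPhenomena.CardyFormulaZ2.Theorems.CardyFlipRussoSquareFromVoronoiHubDefs
import Summits.CriticalPhenomena.CardyFormulaZ2.Theorems.CardyFlipRussoSquareFromVoronoiHubChessboardDefs
import Summits.CriticalPhenomena.CardyFormulaZ2.Theorems.CardyFlipRussoSquareFromVoronoiHubChessboardHypothesisEnd
import Summits.CriticalPhenomena.CardyFormulaZ2.Theorems.CardyFlipRussoSquareFromVoronoiHubChessboardChain
import Summits.CriticalPhenomena.CardyFormulaZ2.Theorems.CardyFlipRussoSquareFromVoronoiHubChessboardLower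
import Summits.CriticalPhenomena.CardyFormulaZ2.Theorems.CardyFlipRussoSquareFromVoronoiHubChessboardUpper
import Summits.CriticalPhenomena.CardyFormulaZ2.Theorems.CardyFlipRussoSquareFromVoronoiHubChessboardDensity
import Summits.CriticalPhenomena.CardyFormulaZ2.Theorems.CardyFlipRussoSquareFromVoronoiHubChessboardTiling
import Summits.CriticalPhenomena.CardyFormulaZ2.Theorems.CardyFlipRussoSquareFromVoronoiHubChessboardEndpointPart1
import Summits.CriticalPhenomena.CardyFormulaZ2.Theorems.CardyFlipRussoSquareFromVoronoiHubChessboardEndpoint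
import Literature.Probability.Percolation.VoronoiCrossing
import Literature.Probability.Percolation.SitePaths
import HarnessLib

/-!
# SKELETON v3 of the line `Sketch` (round 2, card `poissonised-chessboard`) for crux `SquareFromVoronoiHub`
# (stmt-CriticalPhenomena-6434, route `CardyFlipRusso`; lead c4, 2026-08-17)

All definitions and six of the seven registered stubs are LANDED:
`…ChessboardDefs` (p149035: `blkUnit`, `blk`, `LegConfig`, `blackNuclei`, `whiteNuclei`, `legMeasure`,
`legCrossing`, `legProb`, `mOf`, `sOf`, glue `stub_chessboardGlue`), `…ChessboardHypothesisEnd` (p150051,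
S1 `stub_hypothesisEnd`), `…ChessboardChain` (p150727, S3 `stub_blockChain`), `…ChessboardLower` (p151351, S4
`stub_lowerCrossing`), `…ChessboardUpper` (p151375, S5 `stub_upperExclusion`), `…ChessboardDensity` (p152588,
S6 `stub_densityWhp`), `…ChessboardTiling` (p151763, helper `stub_tiling`).  `…ChessboardEndpointPart1` (p153348) and
`…ChessboardEndpoint` (p153460, S7 `stub_endpointSandwich_of`).  Open here: ONLY S2 `stub_legConstancy` (THE KERNEL —
an open problem: divide-and-colour crossing universality along the leg).  So the crux is KERNEL-CHECKED
⟸ `stub_legConstancy`, with both ends of the leg proved.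
-/

noncomputable section

open scoped Topology
open Filter Set MeasureTheory Metric
open Literature.Analysis.FunctionSpaces (PointConfig IsPoissonPointProcess)
open Literature.Probability.RandomPlanarGeometry (ConformalRectangle cardyFunction crossRatio)
open Literature.Probability.Percolation (SiteConfig sitePercolation half voronoiCrossing blackRegion PathIn)
open Summit.CriticalPhenomena.CardyFormulaZ2.Cruxes.SquareFromVoronoiHub.VoronoiBlocks
  (zGs Gs crudeCrossing siteCrossingProb voronoiCrossingProb squareFromVoronoiHub_iff)

namespace Summit.CriticalPhenomena.CardyFormulaZ2.Cruxes.SquareFromVoronoiHub.PoissonisedChessboard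

/-- **S2 `stub_legConstancy` — THE OPEN STUB (the card's C⁺, kernel in leg form).**  Along the
poissonised-chessboard leg the annealed crossing probabilities are asymptotically constant in the
block-type fraction `u`, uniformly on `[0,1]`.  An instance of the divide-and-colour universality
conjecture (Bálint–Camia–Meester 2009, Conj. 1.9) for the partition "same `4.8.8` block, block-type"
of a Poisson process; positively associated and `C₄`-symmetric block by block; exact Mecke–Russo
derivative vanishing at `u = 0`.  Nobody in the tree claims a proof. [folklore] -/
theorem stub_legConstancy : ∀ R : ConformalRectangle, ∀ ε > (0 : ℝ), ∀ᶠ δ in 𝓝[>] (0 : ℝ),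
    ∀ u ∈ Icc (0 : ℝ) 1, ∀ u' ∈ Icc (0 : ℝ) 1,
      ∀ PBf PWf PK PBf' PWf' PK' : Measure (PointConfig ℂ),
        IsPoissonPointProcess (ENNReal.ofReal (1 - u) • (volume : Measure ℂ)) PBf →
        IsPoissonPointProcess (ENNReal.ofReal (1 - u) • (volume : Measure ℂ)) PWf →
        IsPoissonPointProcess (ENNReal.ofReal (2 * u) • (volume : Measure ℂ)) PK →
        IsPoissonPointProcess (ENNReal.ofReal (1 - u') • (volume : Measure ℂ)) PBf' →
        IsPoissonPointProcess (ENNReal.ofReal (1 - u') • (volume : Measure ℂ)) PWf' →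
        IsPoissonPointProcess (ENNReal.ofReal (2 * u') • (volume : Measure ℂ)) PK' →
          |legProb PBf PWf PK R (mOf δ) (sOf δ) - legProb PBf' PWf' PK' R (mOf δ) (sOf δ)| ≤ ε := by
  sorry

/-- **The line closes the crux modulo its stubs**: `SquareFromVoronoiHub` BY NAME from the landed glue,
the landed S1, S3–S7 and the ONE open stub S2 (kernel). [folklore] -/
theorem SquareFromVoronoiHub_of :
    Summit.CriticalPhenomena.CardyFormulaZ2.Theses.CardyFlipRusso.SquareFromVoronoiHub :=
  stub_chessboardGlue stub_hypothesisEnd stub_legConstancy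
    (stub_endpointSandwich_of (stub_lowerCrossing stub_blockChain)
      (stub_upperExclusion stub_blockChain) stub_densityWhp)

end Summit.CriticalPhenomena.CardyFormulaZ2.Cruxes.SquareFromVoronoiHub.PoissonisedChessboard

end
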